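import Literature.NumberTheory.EllipticCurves.AnticyclotomicBigGaloisRep
import Literature.NumberTheory.GaloisRepresentations.ContinuousH1
import Mathlib.NumberTheory.Padics.ProperSpace
import HarnessLib

/-!
# Shapiro's lemma for the co-induced module `M = A ⊗ Λ^*(Ψ⁻¹)`, INJECTIVITY half, cocycle level —
# a continuous 1-cocycle of `bigRep κ ρ` whose evaluation-at-`0` on `ker κ` is a coboundary IS a
# coboundary (explicit primitive) — PROVED

Topic `Literature/NumberTheory/EllipticCurves`. Theorems only: no definition, no named fact, no
`sorry`, no instance, no notation. Cell `bsd-stepL`, seat `bsd-stepL-imc-p1` (g11): module M1 of the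
tree-mapped discharge plan `NOTE-prop323-Shapiro-discharge-plan-imc-p1-g11` (HOME/imc-p1/g11/,
sha16 8d624599f2de7878) for the named fact `SkinnerUrban2014.prop323_XAc_equiv_XBigDecomp`
([SU14] Prop. 3.2.3: `Sel^Σ_{K_∞}(T)^∨ ≅ Sel^Σ_K(T ⊗ Λ(ε⁻¹))^∨` — Shapiro's lemma for Selmer groups),
on the tree's co-induced model `BigRepModule 𝒪 p A` = smooth `p`-primary functions `Φ : ℤ_p → A`
with `(g · Φ)(x) = ρ(g)(Φ(x − κ g))` (`AnticyclotomicBigGaloisRep.lean`, `bigRep`).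

## What is proved (generic: any compact topological group `G`, any continuous surjection
## `κ : G → ℤ_p`, any discrete `p`-primary `𝒪`-linear continuous `ρ`)

Shapiro's map in degree one is `Sh(c)(h) = c(h)(0)` for `h ∈ H = ker κ` ([SU14] p. 22: evaluation at
the identity coset; `h ∈ ker κ` acts on the value at `0` through `ρ` alone, `apply_zero_cocycle`).
* `apply_zero_cocycle` — `Sh(c)` IS a 1-cocycle of `(H, ρ|_H)`: `c(h₁h₂)(0) = c(h₁)(0) + ρ(h₁)(c(h₂)(0))`.
* **`exists_eq_bigRep_sub_of_apply_zero_eq`** (INJECTIVITY of Shapiro on `H¹`, explicit form): if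
  `Sh(c)` is the coboundary of `a ∈ A` on `H` (`c(h)(0) = ρ(h)a − a` for `κ h = 1`), then `c` is the
  coboundary of an explicit `Φ ∈ M` with `Φ(0) = a`: `Φ(κ g) := ρ(g)a − c(g)(κ g)` — well defined
  because the right-hand side is `ker κ`-invariant in `g` (`shapiroPrimitiveFun_mul_of_ker`), SMOOTH
  because it is continuous on `G` and `κ : G → ℤ_p` is a quotient map (compact onto Hausdorff) and a
  continuous map `ℤ_p → A` (discrete) is constant on cosets of some `pⁿℤ_p` (Lebesgue number,
  `exists_isSmoothOfLevel_of_continuous`), `p`-PRIMARY uniformly because its range is finite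
  (`exists_uniform_pow_smul_eq_zero`); and `c(g) = g·Φ − Φ` is the cocycle identity
  `c(g_x) = c(g) + g·c(g⁻¹g_x)` read at `x = κ g_x`.
* `bigRep_sub_apply_zero` — conversely a coboundary `g·Φ − Φ` has `Sh` equal to the coboundary of
  `Φ(0)` (so `Sh` is well defined on classes; the trivial direction).
Not here (later modules of the plan): surjectivity of `Sh` (M2), the local conditions (M3), the
`Λ`-linearity `Sh ∘ (1+T) = conj_γ ∘ Sh` (M4), and the `H¹`-level packaging against Mathlib's
`continuousCohomology 1` (M5; immediate from `oneCocycleClass_eq_zero_iff` on both sides).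

HONEST FRAMING: group cohomology of an induced module, nothing about elliptic curves, Selmer groups or
BSD; the named fact `prop323_…` is NOT discharged by this file.

References: [SkinnerUrban2014] §3.1.1–3.1.2 and Prop. 3.2.3 with its proof (pp. 16–18, 21–22);
[SerreGaloisCohomology1997] I §2.5 (induced modules, Shapiro's lemma); [NeukirchSchmidtWingberg2008]
(1.6.4). Tree: `AnticyclotomicBigGaloisRep.lean` (`BigRepModule`, `IsSmoothOfLevel`, `bigRep`,
`bigRep_apply_apply`), `BigRepModuleShiftStructureProofs.lean` (constants; r17).
-/

noncomputable section

open Filter Topology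
open Literature.NumberTheory.GaloisRepresentations

namespace Literature.NumberTheory.EllipticCurves.BigRepModule

universe u

variable {𝒪 : Type*} [CommRing 𝒪] {p : ℕ} [Fact p.Prime] {A : Type u} [AddCommGroup A] [Module 𝒪 A]

/-! ## §1 Smooth functions on `ℤ_p`: continuity, uniform level, uniform torsion -/

section Smooth

variable [TopologicalSpace A] [DiscreteTopology A]

omit [AddCommGroup A] [Module 𝒪 A] in
/-- A function of level `n` is continuous (`A` discrete): it is constant on the OPEN cosets
`x + pⁿℤ_p = {y : ‖y − x‖ ≤ p⁻ⁿ}`. [cite: SkinnerUrban2014, §3.1.1 (Maps(Γ/Γ^{pⁿ}, ·) as functions on Γ)] -/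
theorem continuous_of_isSmoothOfLevel {n : ℕ} {Φ : ℤ_[p] → A} (hΦ : IsSmoothOfLevel p A n Φ) :
    Continuous Φ := by
  refine (IsLocallyConstant.iff_continuous Φ).1 ((IsLocallyConstant.iff_eventually_eq Φ).2 fun x ↦ ?_)
  have hopen : IsOpen {y : ℤ_[p] | ‖y - x‖ ≤ (p : ℝ) ^ (-(n : ℤ))} := by
    have : {y : ℤ_[p] | ‖y - x‖ ≤ (p : ℝ) ^ (-(n : ℤ))} = Metric.closedBall x ((p : ℝ) ^ (-(n : ℤ))) := by
      ext y; simp [Metric.mem_closedBall, dist_eq_norm]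
    rw [this]
    exact IsUltrametricDist.isOpen_closedBall x (zpow_ne_zero _ (Nat.cast_ne_zero.2 (Fact.out : p.Prime).ne_zero))
  filter_upwards [hopen.mem_nhds (by simp)] with y hy
  exact hΦ y x ((PadicInt.norm_le_pow_iff_mem_span_pow _ n).1 hy)

/-- An element of the big module is a continuous function `ℤ_p → A`. [cite: SkinnerUrban2014, §3.1.1] -/
theorem continuous_coe (Φ : BigRepModule 𝒪 p A) : Continuous (Φ : ℤ_[p] → A) := by
  obtain ⟨n, hn⟩ := Φ.exists_level
  exact continuous_of_isSmoothOfLevel hn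

omit [AddCommGroup A] [Module 𝒪 A] in
/-- **A continuous function `ℤ_p → A` (`A` discrete) is smooth of some level** (uniform local
constancy on the compact `ℤ_p`: Lebesgue number of the open cover by the fibres, then `p⁻ⁿ < δ`).
[cite: SkinnerUrban2014, §3.1.1 and proof of Prop. 3.2.3 (`Λ^* = lim→ Maps(Γ/Γ^{pⁿ}, ·)`)] -/
theorem exists_isSmoothOfLevel_of_continuous {Φ : ℤ_[p] → A} (hΦ : Continuous Φ) :
    ∃ n : ℕ, IsSmoothOfLevel p A n Φ := by
  -- Lebesgue number of the open cover of `ℤ_p` by the fibres of `Φ`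
  obtain ⟨δ, hδ, hcov⟩ := lebesgue_number_lemma_of_metric (ι := A) (c := fun a ↦ Φ ⁻¹' {a})
    (isCompact_univ (X := ℤ_[p])) (fun a ↦ (isOpen_discrete {a}).preimage hΦ)
    (fun x _ ↦ Set.mem_iUnion.2 ⟨Φ x, rfl⟩)
  have hp1 : (1 : ℝ) < p := by exact_mod_cast (Fact.out : p.Prime).one_lt
  obtain ⟨n, hn⟩ := exists_pow_lt_of_lt_one hδ (inv_lt_one_of_one_lt₀ hp1)
  refine ⟨n, fun x y hxy ↦ ?_⟩
  obtain ⟨a, ha⟩ := hcov x (Set.mem_univ x)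
  have hx : Φ x = a := ha (Metric.mem_ball_self hδ)
  have hy : Φ y = a := by
    refine ha (Metric.mem_ball.2 ?_)
    rw [dist_eq_norm, ← neg_sub, norm_neg]
    refine lt_of_le_of_lt ((PadicInt.norm_le_pow_iff_mem_span_pow _ n).2 hxy) ?_
    rwa [zpow_neg, zpow_natCast, ← inv_pow]
  rw [hx, hy]

omit [Fact p.Prime] [Module 𝒪 A] [TopologicalSpace A] [DiscreteTopology A] in
/-- A pointwise `p`-power-torsion function with FINITE range is uniformly `p`-power-torsion.
[cite: SkinnerUrban2014, §3.1.1 (`T ⊗ Λ^*` is `p`-primary)] -/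
theorem exists_uniform_pow_smul_eq_zero {X : Type*} {Φ : X → A} (hfin : (Set.range Φ).Finite)
    (htor : ∀ x, ∃ k : ℕ, p ^ k • Φ x = 0) : ∃ k : ℕ, ∀ x, p ^ k • Φ x = 0 := by
  classical
  -- an exponent for every value in the (finite) range
  have hval : ∀ v ∈ hfin.toFinset, ∃ k : ℕ, p ^ k • v = 0 := by
    intro v hv
    obtain ⟨x, rfl⟩ := (Set.Finite.mem_toFinset hfin).1 hv
    exact htor x
  choose! kv hkv using hval
  refine ⟨hfin.toFinset.sup kv, fun x ↦ ?_⟩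
  have hx : Φ x ∈ hfin.toFinset := (Set.Finite.mem_toFinset hfin).2 ⟨x, rfl⟩
  obtain ⟨m, hm⟩ := Nat.exists_eq_add_of_le (Finset.le_sup (f := kv) hx)
  rw [hm, pow_add, mul_comm, mul_smul, hkv _ hx, smul_zero]

end Smooth

/-! ## §2 The Shapiro map `c ↦ (h ↦ c(h)(0))` on cocycles and the explicit primitive -/

section Shapiro

variable [TopologicalSpace 𝒪] [TopologicalSpace A] [DiscreteTopology A]
  {G : Type u} [Group G] [TopologicalSpace G] [IsTopologicalGroup G]
  [TopologicalSpace (PowerSeries 𝒪)]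
  (κ : G →ₜ* Multiplicative ℤ_[p]) (ρ : ContinuousRep G 𝒪 A)

/-- **`Sh(c)` is a cocycle of `(ker κ, ρ)`**: for a 1-cocycle `c` of `bigRep κ ρ` and `h₁, h₂` with
`κ h₁ = 1`, `c(h₁h₂)(0) = c(h₁)(0) + ρ(h₁)(c(h₂)(0))` — an element of `ker κ` does not move the
argument. [cite: SkinnerUrban2014, Prop. 3.2.3 (proof: Shapiro's map, evaluation at the identity coset)] -/
theorem apply_zero_cocycle {c : G → BigRepModule 𝒪 p A}
    (hc : ∀ g h : G, c (g * h) = c g + bigRep κ ρ g (c h)) {h₁ : G} (hh₁ : κ h₁ = 1) (h₂ : G) :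
    c (h₁ * h₂) 0 = c h₁ 0 + ρ h₁ (c h₂ 0) := by
  rw [hc, BigRepModule.add_apply, bigRep_apply_apply, hh₁, toAdd_one, sub_zero]

/-- **The trivial direction**: the Shapiro image of a coboundary `g ↦ g·Φ − Φ` is the coboundary of
`Φ(0)` on `ker κ`. [cite: SkinnerUrban2014, Prop. 3.2.3 (proof)] -/
theorem bigRep_sub_apply_zero (Φ : BigRepModule 𝒪 p A) {h : G} (hh : κ h = 1) :
    (bigRep κ ρ h Φ - Φ) 0 = ρ h (Φ 0) - Φ 0 := by
  rw [BigRepModule.sub_apply, bigRep_apply_apply, hh, toAdd_one, sub_zero]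

variable {κ ρ}

/-- The candidate primitive read on `G`: `F(g) = ρ(g)a − c(g)(κ g)`. It is RIGHT `ker κ`-INVARIANT
when `Sh(c)` is the coboundary of `a`: `F(g h) = F(g)` for `κ h = 1` (so it descends to
`ℤ_p = G / ker κ`). [cite: SkinnerUrban2014, Prop. 3.2.3 (proof)] -/
theorem shapiroPrimitiveFun_mul_of_ker {c : G → BigRepModule 𝒪 p A}
    (hc : ∀ g h : G, c (g * h) = c g + bigRep κ ρ g (c h)) {a : A}
    (hSh : ∀ h : G, κ h = 1 → c h 0 = ρ h a - a) (g : G) {h : G} (hh : κ h = 1) :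
    ρ (g * h) a - c (g * h) (κ (g * h)).toAdd = ρ g a - c g (κ g).toAdd := by
  have hκ : (κ (g * h)).toAdd = (κ g).toAdd := by rw [map_mul, hh, mul_one]
  rw [hκ, hc, BigRepModule.add_apply, bigRep_apply_apply, sub_self, hSh h hh, map_mul,
    Module.End.mul_apply, map_sub]
  abel

omit [IsTopologicalGroup G] [TopologicalSpace (PowerSeries 𝒪)] in
/-- `F(g) = ρ(g)a − c(g)(κ g)` is continuous on `G` (`A` discrete): `g ↦ ρ(g)a` by continuity of the
action, `g ↦ c(g)(κ g)` because `c` is locally constant and each `c(g) : ℤ_p → A` is continuous.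
[cite: SkinnerUrban2014, Prop. 3.2.3 (proof)] -/
theorem continuous_shapiroPrimitiveFun {c : G → BigRepModule 𝒪 p A} (hcont : Continuous c) (a : A) :
    Continuous fun g : G ↦ ρ g a - c g (κ g).toAdd := by
  have h1 : Continuous fun g : G ↦ ρ g a :=
    ρ.continuous_smul.comp (Continuous.prodMk_left a)
  have hκ : Continuous fun g : G ↦ (κ g).toAdd := continuous_toAdd.comp κ.continuous_toFun
  have h2 : Continuous fun g : G ↦ c g (κ g).toAdd := by
    refine continuous_iff_continuousAt.2 fun g₀ ↦ ?_
    have hlc : ∀ᶠ g in 𝓝 g₀, c g = c g₀ :=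
      ((IsLocallyConstant.iff_eventually_eq c).1 ((IsLocallyConstant.iff_continuous c).2 hcont)) g₀
    have h₀ : ContinuousAt (fun g : G ↦ c g₀ (κ g).toAdd) g₀ :=
      ((continuous_coe (c g₀)).comp hκ).continuousAt
    refine h₀.congr ?_
    filter_upwards [hlc] with g hg
    rw [hg]
  exact h1.sub h2

variable [CompactSpace G]

/-- **SHAPIRO INJECTIVITY for the co-induced module, explicit form.** Let `G` be a compact topological
group, `κ : G → ℤ_p` a continuous SURJECTIVE homomorphism, `ρ` a continuous `𝒪`-linear
representation of `G` on a discrete `p`-primary `A`, and `c : G → M = BigRepModule 𝒪 p A` a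
continuous 1-cocycle of `bigRep κ ρ` (`c(gh) = c(g) + g·c(h)`). If the Shapiro image `h ↦ c(h)(0)` of
`c` on `ker κ` is the coboundary of `a ∈ A` (`c(h)(0) = ρ(h)a − a` whenever `κ h = 1`), then `c` is
the coboundary of the element `Φ ∈ M` with `Φ(κ g) = ρ(g)a − c(g)(κ g)` — in particular `Φ(0) = a` and
`c(g) = g·Φ − Φ` for every `g ∈ G`. Hence Shapiro's map `H¹(G, M) → H¹(ker κ, A)` is injective.
[cite: SkinnerUrban2014, Prop. 3.2.3 (proof: "Appealing to Shapiro's lemma … `H¹(F_∞, T ⊗_A A^*) = … = H¹(F, T ⊗_A Λ^*_{F,A}(ε_F⁻¹))`")]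
[cite: SerreGaloisCohomology1997, I §2.5 (Shapiro's lemma)] -/
theorem exists_eq_bigRep_sub_of_apply_zero_eq (hκ : Function.Surjective κ)
    (hA : ∀ a : A, ∃ k : ℕ, p ^ k • a = 0)
    {c : G → BigRepModule 𝒪 p A} (hcont : Continuous c)
    (hc : ∀ g h : G, c (g * h) = c g + bigRep κ ρ g (c h)) {a : A}
    (hSh : ∀ h : G, κ h = 1 → c h 0 = ρ h a - a) :
    ∃ Φ : BigRepModule 𝒪 p A, Φ 0 = a ∧ ∀ g : G, c g = bigRep κ ρ g Φ - Φ := by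
  classical
  -- the primitive on `G` and its descent to `ℤ_p`
  set F : G → A := fun g ↦ ρ g a - c g (κ g).toAdd with hF
  have hκ' : ∀ x : ℤ_[p], ∃ g : G, (κ g).toAdd = x := fun x ↦ by
    obtain ⟨g, hg⟩ := hκ (Multiplicative.ofAdd x)
    exact ⟨g, by rw [hg, toAdd_ofAdd]⟩
  choose sec hsec using hκ'
  set Φf : ℤ_[p] → A := fun x ↦ F (sec x) with hΦf
  -- `Φf (κ g) = F g`: independence of the representative
  have hΦF : ∀ g : G, Φf (κ g).toAdd = F g := by
    intro g
    have hk : κ (g⁻¹ * sec (κ g).toAdd) = 1 := by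
      apply Multiplicative.toAdd.injective
      rw [map_mul, map_inv, toAdd_mul, toAdd_inv, hsec, toAdd_one, neg_add_cancel]
    have := shapiroPrimitiveFun_mul_of_ker hc hSh g hk
    rw [mul_inv_cancel_left] at this
    exact this
  -- continuity of `Φf`: `Φf ∘ κ = F` is continuous and `κ : G → ℤ_p` is a quotient map
  have hκc : Continuous fun g : G ↦ (κ g).toAdd := continuous_toAdd.comp κ.continuous_toFun
  have hquot : IsQuotientMap fun g : G ↦ (κ g).toAdd :=
    (hκc.isClosedMap).isQuotientMap hκc fun x ↦ ⟨sec x, hsec x⟩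
  have hΦc : Continuous Φf := by
    rw [hquot.continuous_iff]
    have : Φf ∘ (fun g : G ↦ (κ g).toAdd) = F := funext fun g ↦ hΦF g
    rw [this]
    exact continuous_shapiroPrimitiveFun hcont a
  -- smoothness and uniform torsion ⇒ `Φf ∈ M`
  obtain ⟨n, hn⟩ := exists_isSmoothOfLevel_of_continuous hΦc
  have htor : ∀ x : ℤ_[p], ∃ k : ℕ, p ^ k • Φf x = 0 := by
    intro x
    obtain ⟨k₁, hk₁⟩ := hA a
    obtain ⟨k₂, hk₂⟩ := (c (sec x)).exists_torsion
    refine ⟨k₁ + k₂, ?_⟩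
    have h₁ : p ^ (k₁ + k₂) • ρ (sec x) a = 0 := by
      rw [pow_add, mul_comm, mul_smul, ← map_nsmul, hk₁, map_zero, smul_zero]
    have h₂ : p ^ (k₁ + k₂) • c (sec x) (κ (sec x)).toAdd = 0 := by
      rw [pow_add, mul_smul, hk₂, smul_zero]
    change p ^ (k₁ + k₂) • (ρ (sec x) a - c (sec x) (κ (sec x)).toAdd) = 0
    rw [smul_sub, h₁, h₂, sub_zero]
  obtain ⟨k, hk⟩ := exists_uniform_pow_smul_eq_zero
    (((IsLocallyConstant.iff_continuous Φf).2 hΦc).range_finite) htor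
  refine ⟨BigRepModule.mk Φf ⟨⟨n, hn⟩, ⟨k, hk⟩⟩, ?_, fun g ↦ ?_⟩
  · -- `Φ 0 = a`: `0 = κ 1` and `F 1 = a`
    have h0 : (κ 1).toAdd = (0 : ℤ_[p]) := by rw [map_one, toAdd_one]
    rw [BigRepModule.mk_apply, ← h0, hΦF]
    simp only [hF, map_one, Module.End.one_apply]
    have h1 : c 1 = 0 := by
      have := hc 1 1
      rw [mul_one, map_one, Module.End.one_apply, left_eq_add] at this
      exact this
    rw [h1, BigRepModule.zero_apply, sub_zero]
  · -- `c g = g·Φ − Φ`, read at `x = κ g_x`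
    ext x
    obtain ⟨gx, rfl⟩ : ∃ gx : G, (κ gx).toAdd = x := ⟨sec x, hsec x⟩
    have hdiff : (κ gx).toAdd - (κ g).toAdd = (κ (g⁻¹ * gx)).toAdd := by
      rw [map_mul, map_inv, toAdd_mul, toAdd_inv]; abel
    rw [BigRepModule.sub_apply, bigRep_apply_apply, BigRepModule.mk_apply, BigRepModule.mk_apply,
      hdiff, hΦF, hΦF]
    simp only [hF]
    -- cocycle identity `c gx = c g + g · c (g⁻¹ gx)`
    have hcoc : c gx = c g + bigRep κ ρ g (c (g⁻¹ * gx)) := by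
      rw [← hc, mul_inv_cancel_left]
    have hval := congrArg (fun Ψ : BigRepModule 𝒪 p A ↦ Ψ (κ gx).toAdd) hcoc
    simp only [BigRepModule.add_apply, bigRep_apply_apply] at hval
    rw [hdiff] at hval
    rw [map_sub, ← Module.End.mul_apply, ← map_mul, mul_inv_cancel_left, hval]
    abel

/-- **Shapiro's map is injective on `H¹`** (class-level packaging against Mathlib's continuous
cohomology): a continuous 1-cocycle `c` of the topological representation `(bigRep κ ρ).toTopRep`
whose Shapiro image on `ker κ` is a coboundary has trivial class, `[c] = 0` in `H¹(G, M)`.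
[cite: SkinnerUrban2014, Prop. 3.2.3] [cite: SerreGaloisCohomology1997, I §2.5 (Shapiro's lemma)] -/
theorem oneCocycleClass_eq_zero_of_apply_zero_eq
    [ContinuousSMul (PowerSeries 𝒪) (BigRepModule 𝒪 p A)] (hκ : Function.Surjective κ)
    (hA : ∀ a : A, ∃ k : ℕ, p ^ k • a = 0) (c : contOneCocycles (bigRep κ ρ).toTopRep) {a : A}
    (hSh : ∀ h : G, κ h = 1 → (c.1 h : BigRepModule 𝒪 p A) 0 = ρ h a - a) :
    oneCocycleClass (bigRep κ ρ).toTopRep c = 0 := by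
  obtain ⟨Φ, -, hΦ⟩ := exists_eq_bigRep_sub_of_apply_zero_eq (κ := κ) (ρ := ρ) hκ hA
    (c := fun g ↦ (c.1 g : BigRepModule 𝒪 p A)) c.1.continuous (fun g h ↦ c.2 g h) hSh
  exact (oneCocycleClass_eq_zero_iff _ c).2 ⟨Φ, hΦ⟩

end Shapiro

end Literature.NumberTheory.EllipticCurves.BigRepModule

end
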